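import Mathlib
import Summits.ResolutionOfSingularities.ResolutionOfSingularities.Theorems.WeightedInvariantHypersurfaceLocalGameEFT4
import Summits.ResolutionOfSingularities.ResolutionOfSingularities.Theorems.WeightedInvariantHypersurfaceLocalGameEFT4S
import Summits.ResolutionOfSingularities.ResolutionOfSingularities.Theorems.WeightedInvariantHypersurfaceLocalGameEFT3Seams

/-!
# Door line `local-engine` (crux `HypersurfaceCentreConstruction`, stmt-ResolutionOfSingularities-19897):
# kernel seams for the H2a⁗ modules: `LocalWeightedDropEFT4 p → LocalWeightedDropEFT3 p` (v1, p503932) and the rungs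
# below `LocalWeightedDropEFT4S p` (v2 = TP5′ + TP5″, p504475, the door skeleton v3.1 key)

Theorems only (no definitions, no claims about Hironaka's problem).  The ∀-model stratum-exact open presentation
clause (open′) `JOpenPresentationForall` (p503932, stub-9's TP5′) implies the ∃-model clause (open) `JOpenPresentation`
(p501595) in the presence of (c6) `IotaIsoInvariant`:

* `exists_finiteType_model`: an essentially-of-finite-type LOCAL algebra `S` over a field is the localisation
  `A_𝔪 ≃ S` of a finitely generated subalgebra `A ∋ f` at the prime `𝔪 = 𝔪_S ∩ A` (Mathlib's `Algebra.essFiniteType_iff`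
  with the generating finset enlarged by `f`; the unit-preimage submonoid is `𝔪.primeCompl` because `S` is local);
* `jOpenPresentation_of_forall`: apply (open′) to that model — its hypotheses (regularity of `A_𝔪`, `F ≠ 0`, `F ∈ 𝔪²`)
  are transported along `A_𝔪 ≃ S`, its stratum-exactness `(∀ i, U i ∈ 𝔮) ↔ (F ∈ 𝔮 ∧ ι A_𝔮 F = ι A_𝔪 F)` turns the
  (open)-hypothesis `ι A_𝔮 F = ι S f` (= `ι A_𝔪 F` by (c6)) into `U ⊆ 𝔮`, whence the presentation of `J`;
* `eft3_of_eft4`: so the v1 rungs are linear by kernel seams — EFT4 ⇒ EFT3 ⇒ Strong ⇒ EFT (`eftStrong_of_eft3`,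
  `eft_of_eftStrong`, p504032 / p501595); in particular any refutation of `LocalWeightedDropEFT3 p` refutes
  `LocalWeightedDropEFT4 p` (`mt (eft3_of_eft4 p)`); `eftStrong_of_eft4` is the composite.
* For the v2 module (open″) `JOpenPresentationForallSing` the analogous implication to (open) is NOT proved here and is not
  expected from the typed clauses alone: the stratum iff of (open″) reads «`F ∈ 𝔪_{A_𝔮}²` ∧ same `ι`-value», whereas (open)
  asks the presentation at every prime `𝔮 ∋ F` of `D(h)` with the same `ι`-value, including primes at which `F` is a regular
  parameter; the rungs that do hold verbatim are `eftStrong_of_eft4S` (H2a⁗-S ⇒ H2a″, hence ⇒ H2a′ = `eft_of_eft4S`) and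
  `eftCanonical_of_eft4S`.

OURS, summit-side after-care of the (o16)/(o20) typer of record (res-type-061); AI book-keeping, weaker than expert
review.  [L1 W4.3 · door registrar res-L1-w43-plan-1]
-/

set_option linter.dupNamespace false

noncomputable section

open IsLocalRing Literature.AlgebraicGeometry.Resolution

namespace Summit.ResolutionOfSingularities.ResolutionOfSingularities.Cruxes.HypersurfaceCentreConstruction.LocalEngine

/-! ## A finite-type model of an e.f.t. local algebra through a given element -/

/-- **Finite-type model.**  If `S` is a local algebra essentially of finite type over a field `k₀` and `f ∈ S`, there
is a finitely generated subalgebra `A ⊆ S` containing `f` such that `S` is the localisation of `A` at the prime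
`𝔪 = 𝔪_S ∩ A`. [folklore; Mathlib `Algebra.essFiniteType_iff`] -/
theorem exists_finiteType_model (k₀ : Type) [Field k₀] (S : Type) [CommRing S] [Algebra k₀ S]
    [Algebra.EssFiniteType k₀ S] [IsLocalRing S] (f : S) :
    ∃ (A : Subalgebra k₀ S), A.FG ∧ f ∈ A ∧
      IsLocalization.AtPrime S ((maximalIdeal S).comap (algebraMap A S)) := by
  classical
  obtain ⟨σ, hσ⟩ := (Algebra.essFiniteType_iff k₀ S).mp inferInstance
  refine ⟨Algebra.adjoin k₀ (↑(insert f σ) : Set S), Subalgebra.fg_adjoin_finset _, ?_, ?_⟩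
  · exact Algebra.subset_adjoin (by simp)
  · have hle : Algebra.adjoin k₀ (σ : Set S) ≤ Algebra.adjoin k₀ (↑(insert f σ) : Set S) :=
      Algebra.adjoin_mono (by simp [Set.subset_insert])
    have hcond : IsLocalization
        ((IsUnit.submonoid S).comap (algebraMap (Algebra.adjoin k₀ (↑(insert f σ) : Set S)) S)) S := by
      rw [Algebra.essFiniteType_cond_iff]
      intro s
      obtain ⟨t, ht, htu, hst⟩ := hσ s
      exact ⟨t, hle ht, htu, hle hst⟩
    have heq : ((maximalIdeal S).comap (algebraMap (Algebra.adjoin k₀ (↑(insert f σ) : Set S)) S)).primeCompl =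
        (IsUnit.submonoid S).comap (algebraMap (Algebra.adjoin k₀ (↑(insert f σ) : Set S)) S) := by
      ext a
      simp [Ideal.primeCompl, IsUnit.mem_submonoid_iff, mem_maximalIdeal, mem_nonunits_iff]
    show IsLocalization _ S
    rw [heq]
    exact hcond

/-! ## (open′) + (c6) ⇒ (open) -/

/-- **(open′) implies (open)** given (c6): `IotaIsoInvariant ι → JOpenPresentationForall p ι J → JOpenPresentation p ι J`.
The ∃-model of (open) is the finite-type model `A_𝔪 ≃ S` of `exists_finiteType_model`; the hypotheses of (open′) are
transported along the isomorphism, and stratum-exactness converts `ι A_𝔮 F = ι S f` into `U ⊆ 𝔮`.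
[OURS · L1 W4.3, kernel] -/
theorem jOpenPresentation_of_forall {p : ℕ} {ι : (R : Type) → [CommRing R] → R → Ordinal.{0}}
    {J : (R : Type) → [CommRing R] → R → ℕ → Ideal R} (hc6 : IotaIsoInvariant ι)
    (h : JOpenPresentationForall p ι J) : JOpenPresentation p ι J := by
  intro k₀ _ _ _ S _ _ _ _ f hf0 hf2
  obtain ⟨A₀, hAfg, hfA, hloc⟩ := exists_finiteType_model k₀ S f
  haveI : Algebra.FiniteType k₀ A₀ := (Subalgebra.fg_iff_finiteType A₀).mp hAfg
  haveI := hloc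
  -- the model `e : A₀_𝔪 ≃ S`, `F := f ∈ A₀`
  let 𝔪 : Ideal A₀ := (maximalIdeal S).comap (algebraMap A₀ S)
  let eA : Localization.AtPrime 𝔪 ≃ₐ[A₀] S := Localization.algEquiv 𝔪.primeCompl S
  let e : Localization.AtPrime 𝔪 ≃+* S := eA.toRingEquiv
  let F : A₀ := ⟨f, hfA⟩
  have hF : e (algebraMap A₀ (Localization.AtPrime 𝔪) F) = f := by
    show eA (algebraMap A₀ (Localization.AtPrime 𝔪) F) = f
    rw [AlgEquiv.commutes]
    rfl
  refine ⟨A₀, inferInstance, inferInstance, inferInstance, 𝔪, inferInstance, e, F, hF, ?_⟩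
  -- hypotheses of (open′) at the model
  have hreg : IsRegularLocalRing (Localization.AtPrime 𝔪) := IsRegularLocalRing.of_ringEquiv e.symm
  have hFe : algebraMap A₀ (Localization.AtPrime 𝔪) F = e.symm f := by
    rw [← hF, RingEquiv.symm_apply_apply]
  have hF0 : algebraMap A₀ (Localization.AtPrime 𝔪) F ≠ 0 := by
    intro h0
    apply hf0
    rw [← hF, h0, map_zero]
  have hF2 : algebraMap A₀ (Localization.AtPrime 𝔪) F ∈ (maximalIdeal (Localization.AtPrime 𝔪)) ^ 2 := by
    rw [hFe, ← IsLocalRing.map_ringEquiv_maximalIdeal e.symm, ← Ideal.map_pow]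
    exact Ideal.mem_map_of_mem _ hf2
  obtain ⟨hh, hh𝔪, N, U, W, -, -, hstrat⟩ := h k₀ A₀ 𝔪 F hreg hF0 hF2
  refine ⟨hh, hh𝔪, N, U, W, ?_⟩
  intro 𝔮 _ hh𝔮 hF𝔮 hι m
  have hιm : ι (Localization.AtPrime 𝔪) (algebraMap A₀ (Localization.AtPrime 𝔪) F) = ι S f := by
    rw [← hF]
    exact (hc6 (Localization.AtPrime 𝔪) S e (algebraMap A₀ (Localization.AtPrime 𝔪) F)).symm
  obtain ⟨hiff, hpres⟩ := hstrat 𝔮 hh𝔮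
  exact hpres (hiff.mpr ⟨hF𝔮, hι.trans hιm.symm⟩) m

/-! ## The rungs EFT4 ⇒ EFT3 (v1) and EFT4S ⇒ Strong / Canonical (v2) -/

/-- **H2a⁗ implies H2a‴**: `LocalWeightedDropEFT4 p → LocalWeightedDropEFT3 p` (every clause verbatim except (open′) ⇒
(open), `jOpenPresentation_of_forall` with the (c6) conjunct). [OURS · L1 W4.3, kernel] -/
theorem eft3_of_eft4 (p : ℕ) : LocalWeightedDropEFT4 p → LocalWeightedDropEFT3 p := by
  rintro ⟨ι, J, hc6, hc7, hc8, hc10, hJ, hJs, hgame, hopen, hu, hJu⟩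
  exact ⟨ι, J, hc6, hc7, hc8, hc10, hJ, hJs, hgame, jOpenPresentation_of_forall hc6 hopen, hu, hJu⟩

/-- Composite rung (v1): H2a⁗ ⇒ H2a″ (`eftStrong_of_eft3 ∘ eft3_of_eft4`). [OURS · L1 W4.3, kernel] -/
theorem eftStrong_of_eft4 (p : ℕ) (h : LocalWeightedDropEFT4 p) : LocalWeightedDropEFTStrong p :=
  eftStrong_of_eft3 p (eft3_of_eft4 p h)

/-- **H2a⁗-S implies H2a″** (`LocalWeightedDropEFT4S p → LocalWeightedDropEFTStrong p`; the door skeleton v3.1 key sits above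
the H2a″/H2a′ rungs): (c7), (c8), (c6) carried over, game clause as in `eftStrong_of_eft3` (successors over `𝔪·B ≤ 𝔫` are
among those over `P·B ≤ 𝔫`, admissibility from `span = P`). [OURS · L1 W4.3, kernel] -/
theorem eftStrong_of_eft4S (p : ℕ) : LocalWeightedDropEFT4S p → LocalWeightedDropEFTStrong p := by
  rintro ⟨ι, J, hiso, hgen, husc, -, -, -, hgame, -, -, -⟩
  refine ⟨ι, hgen, husc, hiso, ?_⟩
  intro k₀ _ _ _ S _ _ _ _ f hf0 hf2
  obtain ⟨P, hP, -, -, -, -, n, u, w, hspan, hrk, hpos, hctr, -, hadm, hsucc⟩ :=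
    hgame k₀ S f hf0 hf2
  refine ⟨n, u, w, hspan, hrk, hpos, ?_, ?_⟩
  · intro P' _ hP'
    haveI := hP
    have hle : P ≤ P' := by
      rw [← hctr]
      apply Ideal.span_le.mpr
      rintro x ⟨i, hi, rfl⟩
      exact hP' i hi
    exact hadm P' hle
  · intro 𝔫 _ ht hm hv a g hfg hndvd hsing
    haveI := hP
    have hPm : P ≤ maximalIdeal S := IsLocalRing.le_maximalIdeal hP.ne_top
    exact hsucc 𝔫 ht ((Ideal.map_mono hPm).trans hm) hv a g hfg hndvd hsing

/-- Projection (v2): H2a⁗-S implies the canonical-game candidate `LocalWeightedDropEFTCanonical p`. [OURS · L1 W4.3, kernel] -/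
theorem eftCanonical_of_eft4S (p : ℕ) : LocalWeightedDropEFT4S p → LocalWeightedDropEFTCanonical p := by
  rintro ⟨ι, J, hiso, -, -, -, hJ, -, hgame, -, -, -⟩
  exact ⟨ι, J, hiso, hJ, hgame⟩

end Summit.ResolutionOfSingularities.ResolutionOfSingularities.Cruxes.HypersurfaceCentreConstruction.LocalEngine

end
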